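import Summits.BirchSwinnertonDyer.BirchSwinnertonDyer.Theorems.EisensteinPrimesMazurMCOnX1RankZeroInterludeResidualGL1EvenIndexTwo
import Summits.BirchSwinnertonDyer.BirchSwinnertonDyer.Theorems.EisensteinPrimesMazurMCOnX1RankZeroInterludeResidualGL1Tame
import Literature.NumberTheory.EllipticCurves.H1CorestrictionIndexTwo
import Literature.NumberTheory.EllipticCurves.GreenbergVatsal2000.UnramifiedOutsideFinite
import Literature.NumberTheory.EllipticCurves.CyclotomicZpExtension
import Literature.NumberTheory.EllipticCurves.ZpExtensionProofs
import Literature.NumberTheory.EllipticCurves.HeegnerPointsImaginaryQuadraticProofs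
import Literature.NumberTheory.GaloisRepresentations.AbsIntegersEquiv
import Literature.NumberTheory.GaloisRepresentations.InducedGaloisRep
import Literature.NumberTheory.GaloisRepresentations.ArtinFormalismInductionProofs
import Summits.BirchSwinnertonDyer.BirchSwinnertonDyer.Theorems.EisensteinPrimesTwoVariableInertiaInput
import HarnessLib

/-!
# Crux `MazurMCOnX1RankZero` (item stmt-BirchSwinnertonDyer-19035), line `interlude_with_torsion`, road B input [Even] FROM GREENBERG'S LEMMA 5.9: the generic index-2 vanishing lemma, places, corestriction (§3–§5)

Cell `bsd-eis` (host `run/shared/lean/pub/bsd-eis/`), LEAD `cruxlead-19035` (g0); `--supports` stmt-BirchSwinnertonDyer-19035 as a HELPER.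
Part of the move of the ideator bsd-idea-11 g17's workfile `Cruxes/MazurMCOnX1RankZero/Lines/interlude_roadB_EvenTransport_idea11g17.lean`
(sorry-free; mathematics by that seat, verbatim; split at the 400-line limit into `…InterludeResidualGL1Even{IndexTwo,Core,Twist,}`) into `Theorems/`,
so that the registered stub `stub_greenbergEvenInput` of skeleton v10 ([Even] = Greenberg, LNM 1716, §5 Lemma 5.9 read over `K_∞ ⊃ ℚ_∞`) is
closed MODULO the PUBLISHED named fact `Literature.NumberTheory.IwasawaTheory.greenberg1999_lemma59_even_finite` (p693821). HONEST FRAMING: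
kernel plumbing (inflation–restriction along the index-2 pair `res(ker κ_K) ⊲ ker κ_ℚ`, corestriction, the quadratic twist `M ⊗ ε_K`);
nothing about BSD, Mazur's main conjecture or IMC2 is asserted; Greenberg's Lemma 5.9 itself is NOT proved (named fact).
Contents: §3 restriction to `J` vanishes once it vanishes on `J ∩ N` (`[G:N] = 2`, odd prime order); §4 a converse Greenberg–Vatsal unramified
criterion and prime bookkeeping along `ℤ̄_ℚ ≅ ℤ̄_K`; §5 the corestricted class is unramified everywhere and `finite_image_add_cycSwapH1`.
[cite: Greenberg1999LNM, §5 Lemma 5.9 and proof of Prop. 5.10] [cite: SerreGaloisCohomology1997, I §2.4, I §5.8] [cite: GreenbergVatsal2000, §2]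
-/

noncomputable section

set_option linter.dupNamespace false
set_option autoImplicit false

open scoped NumberField Pointwise
open Field IsDedekindDomain
open Literature.NumberTheory.GaloisRepresentations
open Literature.NumberTheory.EllipticCurves Literature.NumberTheory.EllipticCurves.GreenbergSelmer
open Literature.NumberTheory.EllipticCurves.GreenbergVatsal2000

namespace Summit.BirchSwinnertonDyer.BirchSwinnertonDyer.Theorems.InterludeWithTorsion.EvenTransport
/-! ## §3 Generic: restriction to a subgroup `J` vanishes once it vanishes on `J ∩ N` (`[G : N] = 2`, `M` of odd prime order) -/

section Generic

variable {G : Type} [Group G] [TopologicalSpace G] [IsTopologicalGroup G]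
variable {N : Subgroup G} [N.Normal] {c : G}
variable {M : Type} [AddCommGroup M] [DistribMulAction G M] [TopologicalSpace M] [DiscreteTopology M]

omit [TopologicalSpace G] [IsTopologicalGroup G] [N.Normal] in
/-- In an index-`2` situation `G = N ⊔ N c`, ANY `c' ∉ N` is a coset representative. [folklore] -/
theorem xor_of_not_mem (hc : ∀ b : G, Xor (b * c⁻¹ ∈ N) (b ∈ N)) {c' : G} (hc' : c' ∉ N) (b : G) :
    Xor (b * c'⁻¹ ∈ N) (b ∈ N) := by
  have hcc : c' * c⁻¹ ∈ N := by
    rcases hc c' with h | h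
    · exact h.1
    · exact absurd h.1 hc'
  by_cases hb : b ∈ N
  · refine Or.inr ⟨hb, fun h ↦ hc' ?_⟩
    have := N.mul_mem (N.inv_mem h) hb
    rwa [mul_inv_rev, inv_inv, inv_mul_cancel_right] at this
  · refine Or.inl ⟨?_, hb⟩
    have hbc : b * c⁻¹ ∈ N := by
      rcases hc b with h | h
      · exact h.1
      · exact absurd h.1 hb
    have := N.mul_mem hbc (N.inv_mem hcc)
    rwa [mul_inv_rev, inv_inv, ← mul_assoc, inv_mul_cancel_right] at this

/-- `#M • θ = 0` for every class `θ ∈ H¹(G, M)` (`M` finite). [folklore] -/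
theorem natCard_nsmul_eq_zero (θ : discreteH1 G M) : Nat.card M • θ = 0 := by
  obtain ⟨f, rfl⟩ := oneCocycleClass_surjective _ θ
  have hf : Nat.card M • f = 0 := by
    apply Subtype.ext
    ext g
    rw [nsmul_apply_val, card_nsmul_eq_zero']
    rfl
  rw [← classHom_apply, ← map_nsmul, hf, map_zero]

/-- `2 • θ = 0` and `p • θ = 0` with `p` odd force `θ = 0`. [folklore] -/
theorem eq_zero_of_two_nsmul_of_odd_nsmul {A : Type} [AddCommGroup A] {θ : A} (h2 : 2 • θ = 0) {p : ℕ} (hp : Odd p)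
    (hpθ : p • θ = 0) : θ = 0 := by
  obtain ⟨k, rfl⟩ := hp
  rw [add_nsmul, one_nsmul, mul_nsmul, h2, nsmul_zero, zero_add] at hpθ
  exact hpθ

/-- **Restriction to `J` dies once it dies on `J ∩ N`** (`N ⊲ G` open of index `2`, `M` of odd prime order `p`): if
`J ≤ N` there is nothing to do; otherwise `J ∩ N` has index `2` in `J` with a representative `c' ∈ J ∖ N`, the kernel of
`H¹(J, M) → H¹(J ∩ N, M)` is killed by `2` (`two_nsmul_eq_zero_of_resSubgroupH1_eq_zero`, i.e. `cor ∘ res = 2`) and by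
`p = #M`, hence is `0`. [cite: SerreGaloisCohomology1997, I §2.4 Cor. to Prop. 9] -/
theorem resSubgroupH1_eq_zero_of_res_subgroupOf_eq_zero (hN : IsOpen (N : Set G))
    (hM : ∀ m : M, Continuous fun g : G ↦ g • m) (hc : ∀ b : G, Xor (b * c⁻¹ ∈ N) (b ∈ N))
    {p : ℕ} (hp : p.Prime) (hp2 : p ≠ 2) (hcard : Nat.card M = p) (J : Subgroup G) (η : discreteH1 G M)
    (hη : resSubgroupH1 (N.subgroupOf J) M (resSubgroupH1 J M η) = 0) : resSubgroupH1 J M η = 0 := by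
  by_cases hJ : J ≤ N
  · obtain ⟨f, rfl⟩ := oneCocycleClass_surjective _ η
    rw [resSubgroupH1_oneCocycleClass, resSubgroupH1_oneCocycleClass, oneCocycleClass_eq_zero_iff] at hη
    obtain ⟨m, hm⟩ := hη
    rw [resSubgroupH1_oneCocycleClass, oneCocycleClass_eq_zero_iff]
    refine ⟨m, fun g ↦ ?_⟩
    exact hm ⟨g, Subgroup.mem_subgroupOf.mpr (hJ g.2)⟩
  · obtain ⟨c', hc'J, hc'N⟩ := SetLike.not_le_iff_exists.mp hJ
    have hNJ : IsOpen ((N.subgroupOf J : Subgroup J) : Set J) := hN.preimage continuous_subtype_val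
    have hMJ : ∀ m : M, Continuous fun g : J ↦ g • m := fun m ↦ (hM m).comp continuous_subtype_val
    have hcJ : ∀ b : J, Xor (b * (⟨c', hc'J⟩ : J)⁻¹ ∈ N.subgroupOf J) (b ∈ N.subgroupOf J) := fun b ↦ by
      rw [Subgroup.mem_subgroupOf, Subgroup.mem_subgroupOf, Subgroup.coe_mul, Subgroup.coe_inv]
      exact xor_of_not_mem hc hc'N (b : G)
    have h2 : 2 • resSubgroupH1 J M η = 0 := two_nsmul_eq_zero_of_resSubgroupH1_eq_zero hNJ hMJ hcJ hη
    have hpη : p • resSubgroupH1 J M η = 0 := by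
      rw [← hcard]
      exact natCard_nsmul_eq_zero _
    exact eq_zero_of_two_nsmul_of_odd_nsmul h2 (hp.odd_of_ne_two hp2) hpη

omit [N.Normal] in
/-- Translation between the two restriction formalisms: if `res : H¹(H, M) → H¹(I.comap H.subtype, M)` (tool
`resSubgroupH1`) kills `y`, so does `resOfLe : H¹(H, M) → H¹(I ⊓ H, M)` (Greenberg–Vatsal formalism). [folklore] -/
theorem resOfLe_inf_eq_zero_of_resSubgroupH1_eq_zero (H I : Subgroup G) (y : subgroupH1 H M)
    (h : resSubgroupH1 (I.comap H.subtype) M y = 0) : resOfLe M (inf_le_right : I ⊓ H ≤ H) y = 0 := by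
  obtain ⟨f, rfl⟩ := oneCocycleClass_surjective _ y
  rw [resSubgroupH1_oneCocycleClass, oneCocycleClass_eq_zero_iff] at h
  obtain ⟨a, ha⟩ := h
  rw [CocycleCriteria.resOfLe_oneCocycleClass_eq_zero_iff]
  refine ⟨a, fun x ↦ ?_⟩
  exact ha ⟨⟨(x : G), x.2.2⟩, x.2.1⟩

end Generic

/-! ## §4 Places: a converse Greenberg–Vatsal criterion and prime bookkeeping along `ℤ̄_ℚ ≅ ℤ̄_K` -/

section Places

variable {k : Type} [Field k] [NumberField k]
variable (H : Subgroup (absoluteGaloisGroup k)) [H.Normal]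
variable (M : Type) [AddCommGroup M] [DistribMulAction (absoluteGaloisGroup k) M] [TopologicalSpace M]
  [DiscreteTopology M]

variable {H M} in
/-- **Converse Greenberg–Vatsal criterion**: a class dying on EVERY `I_𝔓 ∩ H`, `𝔓 ∣ v`, has all its conjugates in
`unramifiedKer H M v` (the conjugate by `σ` is tested on `I_{𝔓₀}`, and `σ⁻¹ I_{𝔓₀} σ = I_{σ⁻¹ 𝔓₀}`).
[cite: GreenbergVatsal2000, §2 pp. 16–17] [cite: NeukirchANT1999, Ch. I §9 Prop. (9.1)] -/
theorem conjH1_mem_unramifiedKer_of_forall_resOfLe (c : subgroupH1 H M) (v : HeightOneSpectrum (𝓞 k))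
    (h : ∀ 𝔓 ∈ v.primesAbove, resOfLe M (inf_le_right : 𝔓.inertia (absoluteGaloisGroup k) ⊓ H ≤ H) c = 0)
    (σ : absoluteGaloisGroup k) : conjH1 H M σ c ∈ unramifiedKer H M v := by
  classical
  obtain ⟨z, rfl⟩ := oneCocycleClass_surjective _ c
  rw [conjH1_oneCocycleClass_mem_unramifiedKer_iff]
  have h𝔓 : σ⁻¹ • adicCompletionPrime k v ∈ v.primesAbove :=
    smul_mem_primesAbove (adicCompletionPrime_mem_primesAbove k v) σ⁻¹
  have h1 := h _ h𝔓
  rw [CocycleCriteria.resOfLe_oneCocycleClass_eq_zero_iff] at h1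
  obtain ⟨b, hb⟩ := h1
  refine ⟨σ • b, fun y ↦ ?_⟩
  have hyH : ((y : decomp (K := k) v) : absoluteGaloisGroup k) ∈ H := ((mem_inertiaIn_iff H v _).1 y.2).1
  have hyI : ((y : decomp (K := k) v) : absoluteGaloisGroup k) ∈ GreenbergSelmer.inertia v :=
    ((mem_inertiaIn_iff H v _).1 y.2).2
  have hxI : σ⁻¹ * ((y : decomp (K := k) v) : absoluteGaloisGroup k) * σ ∈
      (σ⁻¹ • adicCompletionPrime k v).inertia (absoluteGaloisGroup k) := by
    rw [Summit.BirchSwinnertonDyer.BirchSwinnertonDyer.Theorems.IwasawaTwoVariable.greenbergSelmer_inertia_eq] at hyI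
    have := (Ideal.conj_mem_inertia_smul_iff (adicCompletionPrime k v) σ⁻¹ _).mpr hyI
    simpa only [inv_inv] using this
  have hxH : σ⁻¹ * ((y : decomp (K := k) v) : absoluteGaloisGroup k) * σ ∈ H :=
    Subgroup.Normal.conj_mem' inferInstance _ hyH σ
  let x : ↥((σ⁻¹ • adicCompletionPrime k v).inertia (absoluteGaloisGroup k) ⊓ H) :=
    ⟨σ⁻¹ * ((y : decomp (K := k) v) : absoluteGaloisGroup k) * σ, hxI, hxH⟩
  have key := hb x
  have e : subgroupConj H σ (inertiaInToH H v y) = Subgroup.inclusion inf_le_right x := by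
    apply Subtype.ext
    rw [subgroupConj_apply_coe]
    rfl
  rw [e, key]
  change σ • ((σ⁻¹ * ((y : decomp (K := k) v) : absoluteGaloisGroup k) * σ) • b - b) = _
  rw [smul_sub, smul_smul, show σ * (σ⁻¹ * ((y : decomp (K := k) v) : absoluteGaloisGroup k) * σ) =
    ((y : decomp (K := k) v) : absoluteGaloisGroup k) * σ by group, mul_smul]

variable {K : Type} [Field K] [NumberField K]

/-- The prime of `ℤ̄_K` corresponding to a prime `𝔓` of `ℤ̄_ℚ` under `ℤ̄_ℚ ≅ ℤ̄_K` (`absIntegersEquiv`). [folklore] -/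
def primeOver (𝔓 : Ideal (absIntegers (𝓞 ℚ) ℚ)) : Ideal (absIntegers (𝓞 K) K) :=
  𝔓.comap ((absIntegersEquiv ℚ K).symm : absIntegers (𝓞 K) K →+* absIntegers (𝓞 ℚ) ℚ)

/-- `ι⁻¹ (primeOver 𝔓) = 𝔓`. [folklore] -/
theorem comap_primeOver (𝔓 : Ideal (absIntegers (𝓞 ℚ) ℚ)) : (primeOver (K := K) 𝔓).comap (absIntegersMap ℚ K) = 𝔓 := by
  ext x
  rw [Ideal.mem_comap, primeOver, Ideal.mem_comap]
  change (absIntegersEquiv ℚ K).symm (absIntegersMap ℚ K x) ∈ 𝔓 ↔ x ∈ 𝔓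
  rw [← absIntegersEquiv_apply, RingEquiv.symm_apply_apply]

/-- `primeOver 𝔓` is prime. [folklore] -/
theorem isPrime_primeOver {𝔓 : Ideal (absIntegers (𝓞 ℚ) ℚ)} (h : 𝔓.IsPrime) : (primeOver (K := K) 𝔓).IsPrime :=
  Ideal.IsPrime.comap _

/-- **`σ ∈ I_{primeOver 𝔓} ↔ res σ ∈ I_𝔓`.** [cite: NeukirchANT1999, Ch. I §9 (9.4)] -/
theorem mem_inertia_primeOver_iff (𝔓 : Ideal (absIntegers (𝓞 ℚ) ℚ)) (σ : absoluteGaloisGroup K) :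
    σ ∈ (primeOver (K := K) 𝔓).inertia (absoluteGaloisGroup K) ↔
      absGaloisRestrict ℚ K σ ∈ 𝔓.inertia (absoluteGaloisGroup ℚ) := by
  rw [← comap_inertia_comap_absIntegersMap ℚ K (primeOver (K := K) 𝔓), Subgroup.mem_comap, comap_primeOver]
  rfl

/-- **A prime of `ℤ̄_K` over a place `v ∤ p` of `ℚ` lies over a place `w ∤ p` of `K`.** [cite: NeukirchANT1999, Ch. I §9] -/
theorem exists_place_primeOver {p : ℕ} {v : HeightOneSpectrum (𝓞 ℚ)} (hvp : ((p : ℕ) : 𝓞 ℚ) ∉ v.asIdeal)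
    {𝔓 : Ideal (absIntegers (𝓞 ℚ) ℚ)} (h𝔓 : 𝔓 ∈ v.primesAbove) :
    ∃ w : HeightOneSpectrum (𝓞 K), primeOver (K := K) 𝔓 ∈ w.primesAbove ∧ ((p : ℕ) : 𝓞 K) ∉ w.asIdeal := by
  haveI : (primeOver (K := K) 𝔓).IsPrime := isPrime_primeOver h𝔓.1
  have h' : (primeOver (K := K) 𝔓).comap (absIntegersMap ℚ K) ∈ v.primesAbove := by rwa [comap_primeOver]
  obtain ⟨w, hwv, hw𝔔, -⟩ := exists_heightOneSpectrum_of_comap_absIntegersMap_mem_primesAbove h'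
  refine ⟨w, hw𝔔, fun hpw ↦ hvp ?_⟩
  rw [← hwv]
  change algebraMap (𝓞 ℚ) (𝓞 K) ((p : ℕ) : 𝓞 ℚ) ∈ w.asIdeal
  rwa [map_natCast]

end Places

/-! ## §5 The corestricted class is unramified everywhere; finiteness of `(1 + T_{c₀}) · U_K` -/

section Core

variable {K : Type} [Field K] [NumberField K] [IsGalois ℚ K] [Fact (Module.finrank ℚ K = 2)] {p : ℕ} [Fact p.Prime]
variable (κ : ZpExtension K p) (hκ : κ.IsCyclotomic) (κQ : ZpExtension ℚ p) (hκQ : κQ.IsCyclotomic)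
variable (M : Type) [AddCommGroup M] [DistribMulAction (absoluteGaloisGroup ℚ) M]
  [DistribMulAction (absoluteGaloisGroup K) M] [TopologicalSpace M] [DiscreteTopology M]
  (hM : ∀ (σ : absoluteGaloisGroup K) (m : M), σ • m = absGaloisRestrict ℚ K σ • m)
  (hMc : ∀ m : M, Continuous fun g : absoluteGaloisGroup ℚ ↦ g • m)
variable {c₀ : absoluteGaloisGroup ℚ} (hc₀ : c₀ * c₀ = 1) (hc₀K : c₀ ∉ Set.range (absGaloisRestrict ℚ K))

/-- For `[K : ℚ] = 2` Galois, `N ⊲ Γ`. [folklore] -/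
instance normal_resRangeIn' : (resRangeIn (K := K) κQ).Normal := normal_resRangeIn κQ Fact.out

include hMc in
omit [IsGalois ℚ K] [Fact (Module.finrank ℚ K = 2)] [DistribMulAction (absoluteGaloisGroup K) M] [DiscreteTopology M] in
/-- Continuity of the `Γ = ker κ_ℚ`-orbit maps. [folklore] -/
theorem continuous_smul_kerSubgroupQ (m : M) : Continuous fun g : κQ.kerSubgroup ↦ g • m :=
  (hMc m).comp continuous_subtype_val

include hκQ hMc hc₀ hc₀K in
/-- **The corestriction `cor : H¹(N, M) → H¹(ker κ_ℚ, M)`** of the index-`2` pair (`Γ = N ⊔ N c₀`).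
[cite: SerreGaloisCohomology1997, I §2.4] -/
def cor : subgroupH1 (resRangeIn (K := K) κQ) M →+ subgroupH1 κQ.kerSubgroup M :=
  corH1 (isOpen_resRangeIn κQ) (continuous_smul_kerSubgroupQ κQ M hMc) (xor_resRangeIn κQ hκQ Fact.out hc₀ hc₀K)

/-- **The corestricted transported class dies on every inertia group `I_𝔓 ∩ ker κ_ℚ`, `𝔓 ∣ v ∤ p`** (tool formalism):
on `I_𝔓 ∩ N` its cocycle `n ↦ X(res⁻¹ n) + c₀ • X(res⁻¹(c₀⁻¹ n c₀))` is the coboundary of `a₁ + c₀ • a₂`, where `X` dies on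
`I_𝔔 ∩ ker κ_K` (`𝔔 ↔ 𝔓`) by `a₁` and on `I_{𝔔'} ∩ ker κ_K` (`𝔔' ↔ c₀⁻¹ 𝔓`) by `a₂` because `x` is unramified everywhere
(`resOfLe_inertia_inf_eq_zero_of_mem_unramifiedOutside`); then §3 (`[I_𝔓 ∩ Γ : I_𝔓 ∩ N] ≤ 2`, `p` odd).
[cite: GreenbergVatsal2000, §2 pp. 16–17] [cite: SerreGaloisCohomology1997, I §2.4] -/
theorem resSubgroupH1_inertia_cor_toN_eq_zero (hp2 : p ≠ 2) (hcard : Nat.card M = p)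
    {x : subgroupH1 κ.kerSubgroup M} (hx : x ∈ unramifiedOutside κ.kerSubgroup M p ∅)
    {v : HeightOneSpectrum (𝓞 ℚ)} (hvp : ((p : ℕ) : 𝓞 ℚ) ∉ v.asIdeal) {𝔓 : Ideal (absIntegers (𝓞 ℚ) ℚ)}
    (h𝔓 : 𝔓 ∈ v.primesAbove) :
    resSubgroupH1 ((𝔓.inertia (absoluteGaloisGroup ℚ)).comap κQ.kerSubgroup.subtype) M
      (cor κQ hκQ M hMc hc₀ hc₀K (toN κ hκ κQ hκQ M hM x)) = 0 := by
  classical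
  set N := resRangeIn (K := K) κQ with hNdef
  set J := (𝔓.inertia (absoluteGaloisGroup ℚ)).comap κQ.kerSubgroup.subtype with hJdef
  obtain ⟨X, rfl⟩ := oneCocycleClass_surjective _ x
  -- the two coboundary witnesses
  obtain ⟨w, hw𝔔, hwp⟩ := exists_place_primeOver (K := K) hvp h𝔓
  have h₁ := resOfLe_inertia_inf_eq_zero_of_mem_unramifiedOutside hx (Set.notMem_empty w) hwp hw𝔔
  rw [CocycleCriteria.resOfLe_oneCocycleClass_eq_zero_iff] at h₁
  obtain ⟨a₁, ha₁⟩ := h₁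
  have h𝔓' : c₀⁻¹ • 𝔓 ∈ v.primesAbove := smul_mem_primesAbove h𝔓 c₀⁻¹
  obtain ⟨w', hw'𝔔, hw'p⟩ := exists_place_primeOver (K := K) hvp h𝔓'
  have h₂ := resOfLe_inertia_inf_eq_zero_of_mem_unramifiedOutside hx (Set.notMem_empty w') hw'p hw'𝔔
  rw [CocycleCriteria.resOfLe_oneCocycleClass_eq_zero_iff] at h₂
  obtain ⟨a₂, ha₂⟩ := h₂
  -- reduce to `J ∩ N`
  apply resSubgroupH1_eq_zero_of_res_subgroupOf_eq_zero (isOpen_resRangeIn κQ) (continuous_smul_kerSubgroupQ κQ M hMc)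
    (xor_resRangeIn κQ hκQ Fact.out hc₀ hc₀K) (Fact.out : p.Prime) hp2 hcard J
  rw [toN_oneCocycleClass, cor, corH1_oneCocycleClass, resSubgroupH1_oneCocycleClass, resSubgroupH1_oneCocycleClass,
    oneCocycleClass_eq_zero_iff]
  refine ⟨a₁ + c₀ • a₂, fun g ↦ ?_⟩
  have hgN : ((g : J) : κQ.kerSubgroup) ∈ N := Subgroup.mem_subgroupOf.mp g.2
  have hgI : (((g : J) : κQ.kerSubgroup) : absoluteGaloisGroup ℚ) ∈ 𝔓.inertia (absoluteGaloisGroup ℚ) := (g : J).2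
  set n : N := ⟨((g : J) : κQ.kerSubgroup), hgN⟩ with hndef
  rw [resCocycle_apply, resCocycle_apply, corCocycle_apply]
  change corFun _ _ ((n : κQ.kerSubgroup) : κQ.kerSubgroup) = ((n : κQ.kerSubgroup) : absoluteGaloisGroup ℚ) • (a₁ + c₀ • a₂) - (a₁ + c₀ • a₂)
  rw [corFun_coe, symCocycle_apply, pullback_resHomOfEquivariant_apply, pullback_resHomOfEquivariant_apply,
    AddMonoidHom.id_apply, AddMonoidHom.id_apply]
  -- first term
  set σ := resKerInv κ hκ κQ hκQ n with hσdef
  have hσres : absGaloisRestrict ℚ K (σ : absoluteGaloisGroup K) = ((n : κQ.kerSubgroup) : absoluteGaloisGroup ℚ) :=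
    absGaloisRestrict_resKerInv κ hκ κQ hκQ n
  have hσI : (σ : absoluteGaloisGroup K) ∈ (primeOver (K := K) 𝔓).inertia (absoluteGaloisGroup K) := by
    rw [mem_inertia_primeOver_iff, hσres]
    exact hgI
  have e₁ : X.1 σ = ((n : κQ.kerSubgroup) : absoluteGaloisGroup ℚ) • a₁ - a₁ := by
    have := ha₁ ⟨(σ : absoluteGaloisGroup K), hσI, σ.2⟩
    rw [← hσres, ← hM]
    exact this
  -- second term
  set σ' := resKerInv κ hκ κQ hκQ (subgroupConj N (invol hκQ hc₀) n) with hσ'def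
  have hσ'res : absGaloisRestrict ℚ K (σ' : absoluteGaloisGroup K) =
      c₀⁻¹ * ((n : κQ.kerSubgroup) : absoluteGaloisGroup ℚ) * c₀ := by
    rw [hσ'def, absGaloisRestrict_resKerInv]
    rfl
  have hσ'I : (σ' : absoluteGaloisGroup K) ∈ (primeOver (K := K) (c₀⁻¹ • 𝔓)).inertia (absoluteGaloisGroup K) := by
    rw [mem_inertia_primeOver_iff, hσ'res]
    have := (Ideal.conj_mem_inertia_smul_iff 𝔓 c₀⁻¹ _).mpr hgI
    simpa only [inv_inv] using this
  have e₂ : X.1 σ' = (c₀⁻¹ * ((n : κQ.kerSubgroup) : absoluteGaloisGroup ℚ) * c₀) • a₂ - a₂ := by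
    have := ha₂ ⟨(σ' : absoluteGaloisGroup K), hσ'I, σ'.2⟩
    rw [← hσ'res, ← hM]
    exact this
  rw [e₁, e₂, Subgroup.smul_def, coe_invol]
  rw [smul_sub, smul_smul, show c₀ * (c₀⁻¹ * ((n : κQ.kerSubgroup) : absoluteGaloisGroup ℚ) * c₀) =
    ((n : κQ.kerSubgroup) : absoluteGaloisGroup ℚ) * c₀ by group, mul_smul, smul_add]
  abel

/-- **`cor(Φ x)` is unramified everywhere** for `x ∈ U_K = H¹_unr(K_∞, M)`: the Greenberg–Vatsal membership over `ℚ`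
from the vanishing on all `I_𝔓 ∩ ker κ_ℚ` (`conjH1_mem_unramifiedKer_of_forall_resOfLe`).
[cite: GreenbergVatsal2000, §2 pp. 16–17, 23] -/
theorem cor_toN_mem_unramifiedOutside (hp2 : p ≠ 2) (hcard : Nat.card M = p)
    {x : subgroupH1 κ.kerSubgroup M} (hx : x ∈ unramifiedOutside κ.kerSubgroup M p ∅) :
    cor κQ hκQ M hMc hc₀ hc₀K (toN κ hκ κQ hκQ M hM x) ∈ unramifiedOutside κQ.kerSubgroup M p ∅ := by
  rw [mem_unramifiedOutside_iff]
  intro v _ hvp σ₀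
  apply conjH1_mem_unramifiedKer_of_forall_resOfLe
  intro 𝔓 h𝔓
  exact resOfLe_inf_eq_zero_of_resSubgroupH1_eq_zero _ _ _
    (resSubgroupH1_inertia_cor_toN_eq_zero κ hκ κQ hκQ M hM hMc hc₀ hc₀K hp2 hcard hx hvp h𝔓)

/-- **`(1 + T_{c₀}) x = Ψ (res_N (cor (Φ x)))`** on `H¹(ker κ_K, M)`: `res ∘ cor = 1 + (c₀)_*` on `H¹(N, M)`
(`resSubgroupH1_corH1`), `Ψ ∘ Φ = id` and `Ψ ∘ (c₀)_* = T_{c₀} ∘ Ψ`. [cite: SerreGaloisCohomology1997, I §2.4–2.5] -/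
theorem add_cycSwapH1_eq (x : subgroupH1 κ.kerSubgroup M) :
    x + cycSwapH1 κ hκ M hM c₀ x =
      ofN κ hκ κQ hκQ M hM (resSubgroupH1 (resRangeIn (K := K) κQ) M
        (cor κQ hκQ M hMc hc₀ hc₀K (toN κ hκ κQ hκQ M hM x))) := by
  rw [cor, resSubgroupH1_corH1, map_add, ofN_conjH1, ofN_toN]

include hκQ hMc hc₀ hc₀K in
/-- **Core⁺: `(1 + T_{c₀}) · U_K` is finite once `U_ℚ = H¹_unr(ℚ_∞, M)` is finite.**
[cite: Greenberg1999LNM, Lemma 5.9] [cite: SerreGaloisCohomology1997, I §2.4] -/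
theorem finite_image_add_cycSwapH1 (hp2 : p ≠ 2) (hcard : Nat.card M = p)
    (hfin : (unramifiedOutside κQ.kerSubgroup M p ∅ : Set (subgroupH1 κQ.kerSubgroup M)).Finite) :
    ((fun c ↦ c + cycSwapH1 κ hκ M hM c₀ c) ''
      (unramifiedOutside κ.kerSubgroup M p ∅ : Set (subgroupH1 κ.kerSubgroup M))).Finite := by
  refine (hfin.image (fun y ↦ ofN κ hκ κQ hκQ M hM (resSubgroupH1 (resRangeIn (K := K) κQ) M y))).subset ?_
  rintro _ ⟨x, hx, rfl⟩
  exact ⟨_, cor_toN_mem_unramifiedOutside κ hκ κQ hκQ M hM hMc hc₀ hc₀K hp2 hcard hx,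
    (add_cycSwapH1_eq κ hκ κQ hκQ M hM hMc hc₀ hc₀K x).symm⟩

end Core

end Summit.BirchSwinnertonDyer.BirchSwinnertonDyer.Theorems.InterludeWithTorsion.EvenTransport
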